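import Mathlib.LinearAlgebra.Matrix.Permanent
import Mathlib.Data.Complex.Basic
import Mathlib.Data.Fin.Tuple.Sort
import Mathlib.Algebra.BigOperators.Fin
import Mathlib.Data.Fintype.BigOperators
import Literature.LinearAlgebra.Matrix.PermanentSubperm
import Summits.ValiantsHypothesis.ValiantsHypothesis.Theorems.SymPencilPerFourSingularLocusSupportMonomials
import Mathlib.Data.Nat.Bitwise
import Mathlib.Data.Fin.VecNotation
import Mathlib.Logic.Equiv.Fin.Basic
import Mathlib.Data.Fintype.Basic
import Mathlib.Data.Fintype.Prod
import Mathlib.Data.Fintype.Pi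
import Mathlib.Tactic.FinCases
import Mathlib.Tactic.NormNum

/-!
# Zero patterns of `Sing(per₄)` — the finite cover (kernel-decided) and its decoding

Companion of `SymPencilPerFourSingularLocusSupportMonomials` (the two monomial members
`12·x₀₂x₀₃x₁₁³x₂₀x₃₀³`, `12·x₀₀x₀₁x₀₃x₁₂²x₂₁²x₃₀²` of the ideal `J₃(X₄)` of the sixteen `3 × 3`
sub-permanents of a `4 × 4` matrix) and input of `SymPencilPerFourSingularLocusSupportPatterns`
(the support theorem: a `4 × 4` matrix over a domain with `12 ≠ 0` all of whose `3 × 3`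
sub-permanents vanish has a zero row, a zero column, an anti-block zero pattern or cross support).

This file is pure finite combinatorics on 16-bit masks `z` (bit `4 i + j` ↔ cell `(i, j)`):

* `termGen` — the 42 TERMINAL patterns (4 rows, 4 columns, 18 anti-blocks `I × J ∪ Iᶜ × Jᶜ`,
  16 cross complements `([4]∖i₀) × ([4]∖j₀)`), generated from parameters, with their semantics
  (`termSem_of_mem_termGen`);
* `imageMasks` — the 720 images of the monomial supports `U₁ = {02,03,11,20,30}` (144 images),
  `U₂ = {00,01,03,12,21,30}` and its transpose (288 images each) under row and column permutations,
  computed in the kernel from `perms4` (one representative per stabiliser coset, see `witParams`);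
* `ok z` — «`z` contains a terminal pattern, or is disjoint from an image»;
* `checkSorted_eq` — ONE `decide +kernel` (≈ 20 s): `ok z` for every pattern `z` whose row
  zero-counts and column zero-counts are both non-decreasing (1 526 of the 65 536 patterns; every
  matrix is brought to this normal form by sorting rows and columns, which preserves the hypothesis);
  the enumeration runs over nibbles `r₃, r₂, r₁, r₀` with popcount guards, so only the 10 121
  row-sorted patterns are ever formed;
* `ok_of_sorted` — the arithmetic read-back `∀ z < 65536, sortedB z → ok z`.

Helper for crux `CoverDecancellation` (stmt-ValiantsHypothesis-17819), rung `StrengthTwoPerFourGeFour`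
(«str₂(per₄) ≥ 4» ⇐ «codim Sing(per₄) ≥ 7»); closes `stub_noZeroLine_zeros` of the line
`Cruxes/CoverDecancellation/Lines/sing_height_cascade.lean` together with the Patterns file.
val-idea-10 g2, 2026-08-28 (RULING g12-R132 (a): one `decide` under 60 s).  No `sorry`,
no `native_decide`; the `def`s are bookkeeping on masks, no mathematical notion is introduced.
-/


namespace Summit.ValiantsHypothesis.ValiantsHypothesis.Cruxes.CoverDecancellation.SingPerFourSupport

/-! ## §1 Masks -/

/-- Bit index of a cell. -/
def bitIdx (c : Fin 4 × Fin 4) : ℕ := 4 * (c.1 : ℕ) + (c.2 : ℕ)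

/-- The mask of a list of cells. -/
def maskOf (l : List (Fin 4 × Fin 4)) : ℕ := l.foldr (fun c acc => 2 ^ bitIdx c ||| acc) 0

/-- The sixteen cells, listed. -/
def allCells : List (Fin 4 × Fin 4) :=
  [(0,0),(0,1),(0,2),(0,3),(1,0),(1,1),(1,2),(1,3),(2,0),(2,1),(2,2),(2,3),(3,0),(3,1),(3,2),(3,3)]

/-- Every cell is listed in `allCells`. -/
theorem mem_allCells (c : Fin 4 × Fin 4) : c ∈ allCells := by
  revert c; decide

/-- Row, column, anti-block and cross-complement patterns as masks. -/
def rowMask (i : Fin 4) : ℕ := maskOf [(i,0),(i,1),(i,2),(i,3)]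
/-- Column pattern. -/
def colMask (j : Fin 4) : ℕ := maskOf [(0,j),(1,j),(2,j),(3,j)]
/-- Anti-block pattern `I × J ∪ Iᶜ × Jᶜ`, `I = {i₁, i₂}`, `J = {j₁, j₂}`. -/
def antiMask (i₁ i₂ j₁ j₂ : Fin 4) : ℕ :=
  maskOf (allCells.filter fun c => decide ((c.1 = i₁ ∨ c.1 = i₂) ↔ (c.2 = j₁ ∨ c.2 = j₂)))
/-- Cross-complement pattern `([4]∖i₀) × ([4]∖j₀)`. -/
def crossMask (i₀ j₀ : Fin 4) : ℕ :=
  maskOf (allCells.filter fun c => decide (c.1 ≠ i₀ ∧ c.2 ≠ j₀))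

/-- Parameters `(i₁, i₂, j₁, j₂)` of the 18 anti-block patterns (with `0 ∈ I`). -/
def antiParams : List (Fin 4 × Fin 4 × Fin 4 × Fin 4) :=
  [(0,1,0,1),(0,1,0,2),(0,1,0,3),(0,1,1,2),(0,1,1,3),(0,1,2,3),
   (0,2,0,1),(0,2,0,2),(0,2,0,3),(0,2,1,2),(0,2,1,3),(0,2,2,3),
   (0,3,0,1),(0,3,0,2),(0,3,0,3),(0,3,1,2),(0,3,1,3),(0,3,2,3)]

/-- The anti-block parameters are pairs of distinct indices. -/
theorem antiParams_ne : ∀ p ∈ antiParams, p.1 ≠ p.2.1 ∧ p.2.2.1 ≠ p.2.2.2 := by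
  unfold antiParams; decide +kernel

/-- The 42 terminal masks. -/
def termGen : List ℕ :=
  [rowMask 0, rowMask 1, rowMask 2, rowMask 3] ++ [colMask 0, colMask 1, colMask 2, colMask 3] ++
    antiParams.map (fun p => antiMask p.1 p.2.1 p.2.2.1 p.2.2.2) ++
    allCells.map (fun c => crossMask c.1 c.2)

/-- The 24 permutations of `Fin 4` in lexicographic order (consecutive pairs differ by the
transposition of the last two values). -/
def perms4 : List (Fin 4 → Fin 4) := [![0, 1, 2, 3], ![0, 1, 3, 2], ![0, 2, 1, 3], ![0, 2, 3, 1], ![0, 3, 1, 2], ![0, 3, 2, 1], ![1, 0, 2, 3], ![1, 0, 3, 2], ![1, 2, 0, 3], ![1, 2, 3, 0], ![1, 3, 0, 2], ![1, 3, 2, 0], ![2, 0, 1, 3], ![2, 0, 3, 1], ![2, 1, 0, 3], ![2, 1, 3, 0], ![2, 3, 0, 1], ![2, 3, 1, 0], ![3, 0, 1, 2], ![3, 0, 2, 1], ![3, 1, 0, 2], ![3, 1, 2, 0], ![3, 2, 0, 1], ![3, 2, 1, 0]]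

/-- Every entry of `perms4` is a bijection. -/
theorem perms4_bijective : ∀ σ ∈ perms4, Function.Bijective σ := by
  unfold perms4; decide +kernel

/-- Supports: `U₁` (`0`), `U₂` (`1`) and the transpose `U₂ᵀ` (`2`). -/
def baseCells : ℕ → List (Fin 4 × Fin 4)
  | 0 => [(0,2),(0,3),(1,1),(2,0),(3,0)]
  | 1 => [(0,0),(0,1),(0,3),(1,2),(2,1),(3,0)]
  | _ => [(0,0),(1,0),(3,0),(2,1),(1,2),(0,3)]

/-- Where the reindexed matrix `M.submatrix σ τ` reads `M`. -/
def imgCell (σ τ : Fin 4 → Fin 4) (c : Fin 4 × Fin 4) : Fin 4 × Fin 4 := (σ c.1, τ c.2)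

/-- Witness parameters `(a, b, k)`: row / column permutation indices and which support.  The parity
conditions pick one representative per coset of the stabiliser (`U₁`: rows `2↔3` and columns
`2↔3`, 144 images; `U₂`: `(rows 2↔3, cols 0↔1)`, 288 images; `U₂ᵀ`: `(rows 0↔1, cols 2↔3)`,
288 images) — 720 distinct images in all. -/
def witParams : List (ℕ × ℕ × ℕ) :=
  (List.range 24).flatMap fun a => (List.range 24).flatMap fun b =>
    (bif (a % 2 == 0 && b % 2 == 0) then [(a, b, 0)] else []) ++
    (bif (a % 2 == 0) then [(a, b, 1)] else []) ++ (bif (b % 2 == 0) then [(a, b, 2)] else [])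

/-- The image mask of a witness. -/
def witMask (w : ℕ × ℕ × ℕ) : ℕ :=
  maskOf ((baseCells w.2.2).map (imgCell (perms4.getD w.1 id) (perms4.getD w.2.1 id)))

/-- The 720 image masks. -/
def imageMasks : List ℕ := witParams.map witMask

/-- Witness indices are `< 24`. -/
theorem witParams_lt : witParams.all (fun w => decide (w.1 < 24) && decide (w.2.1 < 24)) = true := by
  decide +kernel

/-- The cover predicate: `z` contains a terminal pattern or misses an image. -/
def ok (z : ℕ) : Bool :=
  termGen.any (fun m => z &&& m == m) || imageMasks.any (fun u => z &&& u == 0)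

/-! ## §2 The cover check on count-sorted patterns (one kernel `decide`) -/

/-- Popcount of a nibble; row and column zero-counts of a mask. -/
def pc (n : ℕ) : ℕ := (n.testBit 0).toNat + (n.testBit 1).toNat + (n.testBit 2).toNat + (n.testBit 3).toNat
/-- Row zero-count of a mask. -/
def rcnt (z i : ℕ) : ℕ :=
  (z.testBit (0 + 4 * i)).toNat + (z.testBit (1 + 4 * i)).toNat + (z.testBit (2 + 4 * i)).toNat +
    (z.testBit (3 + 4 * i)).toNat
/-- Column zero-count of a mask. -/
def ccnt (z j : ℕ) : ℕ :=
  (z.testBit (j + 4 * 0)).toNat + (z.testBit (j + 4 * 1)).toNat + (z.testBit (j + 4 * 2)).toNat +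
    (z.testBit (j + 4 * 3)).toNat

/-- «row zero-counts and column zero-counts are non-decreasing». -/
def sortedB (z : ℕ) : Bool :=
  decide (rcnt z 0 ≤ rcnt z 1) && decide (rcnt z 1 ≤ rcnt z 2) && decide (rcnt z 2 ≤ rcnt z 3) &&
  (decide (ccnt z 0 ≤ ccnt z 1) && decide (ccnt z 1 ≤ ccnt z 2) && decide (ccnt z 2 ≤ ccnt z 3))

/-- A mask from its four nibbles. -/
def z4 (r0 r1 r2 r3 : ℕ) : ℕ := r0 + 16 * (r1 + 16 * (r2 + 16 * r3))

/-- The guarded enumeration (guards only prune; the leaf re-tests `sortedB`). -/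
def checkSorted : Bool :=
  (List.range 16).all fun r3 => (List.range 16).all fun r2 => !(decide (pc r2 ≤ pc r3)) ||
    (List.range 16).all fun r1 => !(decide (pc r1 ≤ pc r2)) ||
      (List.range 16).all fun r0 => !(decide (pc r0 ≤ pc r1)) ||
        (!(sortedB (z4 r0 r1 r2 r3)) || ok (z4 r0 r1 r2 r3))

set_option maxHeartbeats 4000000 in
/-- **The cover fact** (kernel): every count-sorted zero pattern contains a terminal pattern or
misses one of the 720 images of `U₁`, `U₂`. -/
theorem checkSorted_eq : checkSorted = true := by
  decide +kernel

/-! ## §3 Reading the cover fact back -/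

/-- Discharging a Boolean guard. -/
theorem of_guard {a b : Bool} (h : (!a || b) = true) (ha : a = true) : b = true := by
  cases a <;> simp_all

/-- Row counts are popcounts of base-16 digits. -/
theorem rcnt_eq_pc (z i : ℕ) : rcnt z i = pc (z / 2 ^ (4 * i) % 2 ^ 4) := by
  simp only [rcnt, pc, Nat.testBit_mod_two_pow, Nat.testBit_div_two_pow]
  simp only [show (0:ℕ) < 4 by norm_num, show (1:ℕ) < 4 by norm_num, show (2:ℕ) < 4 by norm_num,
    show (3:ℕ) < 4 by norm_num, decide_true, Bool.true_and]

/-- `ok z` for every count-sorted pattern `z < 2¹⁶`. -/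
theorem ok_of_sorted (z : ℕ) (hz : z < 65536) (hs : sortedB z = true) : ok z = true := by
  have h0 : rcnt z 0 = pc (z % 16) := by rw [rcnt_eq_pc]; norm_num
  have h1 : rcnt z 1 = pc (z / 16 % 16) := by rw [rcnt_eq_pc]; norm_num
  have h2 : rcnt z 2 = pc (z / 256 % 16) := by rw [rcnt_eq_pc]; norm_num
  have h3 : rcnt z 3 = pc (z / 4096 % 16) := by rw [rcnt_eq_pc]; norm_num
  have hs' := hs
  simp only [sortedB, Bool.and_eq_true, decide_eq_true_eq] at hs'
  obtain ⟨⟨⟨h01, h12⟩, h23⟩, -⟩ := hs'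
  rw [h0, h1] at h01; rw [h1, h2] at h12; rw [h2, h3] at h23
  have e : z4 (z % 16) (z / 16 % 16) (z / 256 % 16) (z / 4096 % 16) = z := by unfold z4; omega
  have rd : ∀ {f : ℕ → Bool}, (List.range 16).all f = true → ∀ {r : ℕ}, r % 16 = r → f r = true :=
    fun h r hr => List.all_eq_true.1 h r (List.mem_range.2 (by omega))
  have A := rd checkSorted_eq (Nat.mod_mod (z / 4096) 16)
  have B := of_guard (rd A (Nat.mod_mod _ _)) (decide_eq_true h23)
  have C := of_guard (rd B (Nat.mod_mod _ _)) (decide_eq_true h12)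
  have D := of_guard (rd C (Nat.mod_mod _ _)) (decide_eq_true h01)
  rw [e] at D
  exact of_guard D hs

/-! ## §4 Decoding masks -/

/-- Bits of `maskOf`. -/
theorem testBit_maskOf (l : List (Fin 4 × Fin 4)) (e : ℕ) :
    (maskOf l).testBit e = true ↔ ∃ c ∈ l, bitIdx c = e := by
  induction l with
  | nil => simp [maskOf]
  | cons c l ih =>
      simp only [maskOf, List.foldr_cons] at ih ⊢
      rw [Nat.testBit_or, Bool.or_eq_true, Nat.testBit_two_pow, ih]
      simp

/-- `bitIdx` is injective. -/
theorem bitIdx_injective : Function.Injective bitIdx := by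
  intro c c' h; revert c c' ; decide

/-- `bitIdx < 16`. -/
theorem bitIdx_lt (c : Fin 4 × Fin 4) : bitIdx c < 16 := by
  unfold bitIdx; omega

/-- Bits of a sub-mask. -/
theorem testBit_of_and_eq_self {z m : ℕ} (h : z &&& m = m) (e : ℕ) (he : m.testBit e = true) :
    z.testBit e = true := by
  have := congrArg (fun n => Nat.testBit n e) h
  simp only [Nat.testBit_and] at this
  rw [he] at this
  simpa using this

/-- Bits of a disjoint mask. -/
theorem testBit_of_and_eq_zero {z u : ℕ} (h : z &&& u = 0) (e : ℕ) (he : u.testBit e = true) :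
    z.testBit e = false := by
  have := congrArg (fun n => Nat.testBit n e) h
  simp only [Nat.testBit_and, Nat.zero_testBit] at this
  rw [he] at this
  simpa using this

/-- Semantics of a terminal mask: the cells it prescribes contain a row, a column, an anti-block
or a cross complement. -/
theorem termSem_of_mem_termGen {m : ℕ} (hm : m ∈ termGen) :
    (∃ i : Fin 4, ∀ j : Fin 4, m.testBit (bitIdx (i, j)) = true) ∨
    (∃ j : Fin 4, ∀ i : Fin 4, m.testBit (bitIdx (i, j)) = true) ∨
    (∃ i₁ i₂ j₁ j₂ : Fin 4, i₁ ≠ i₂ ∧ j₁ ≠ j₂ ∧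
        ∀ i j : Fin 4, ((i = i₁ ∨ i = i₂) ↔ (j = j₁ ∨ j = j₂)) → m.testBit (bitIdx (i, j)) = true) ∨
    (∃ i₀ j₀ : Fin 4, ∀ i j : Fin 4, i ≠ i₀ → j ≠ j₀ → m.testBit (bitIdx (i, j)) = true) := by
  simp only [termGen, List.mem_append, List.mem_cons, List.mem_map, List.not_mem_nil, or_false]
    at hm
  rcases hm with ((hrow | hcol) | ⟨p, hp, rfl⟩) | ⟨c, -, rfl⟩
  · have aux : ∀ i j : Fin 4, (rowMask i).testBit (bitIdx (i, j)) = true := fun i j =>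
      (testBit_maskOf _ _).2 ⟨(i, j), by fin_cases j <;> simp, rfl⟩
    rcases hrow with rfl | rfl | rfl | rfl <;> exact Or.inl ⟨_, aux _⟩
  · have aux : ∀ j i : Fin 4, (colMask j).testBit (bitIdx (i, j)) = true := fun j i =>
      (testBit_maskOf _ _).2 ⟨(i, j), by fin_cases i <;> simp, rfl⟩
    rcases hcol with rfl | rfl | rfl | rfl <;> exact Or.inr (Or.inl ⟨_, aux _⟩)
  · obtain ⟨h1, h2⟩ := antiParams_ne p hp
    refine Or.inr (Or.inr (Or.inl ⟨p.1, p.2.1, p.2.2.1, p.2.2.2, h1, h2, fun i j hij => ?_⟩))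
    exact (testBit_maskOf _ _).2 ⟨(i, j), List.mem_filter.2 ⟨mem_allCells _, decide_eq_true hij⟩, rfl⟩
  · refine Or.inr (Or.inr (Or.inr ⟨c.1, c.2, fun i j hi hj => ?_⟩))
    exact (testBit_maskOf _ _).2 ⟨(i, j), List.mem_filter.2 ⟨mem_allCells _, decide_eq_true ⟨hi, hj⟩⟩, rfl⟩

/-- Decoding an image mask: a witness `(σ, τ, k)` with bijective `σ, τ`. -/
theorem exists_wit_of_mem_imageMasks {u : ℕ} (hu : u ∈ imageMasks) :
    ∃ (σ τ : Fin 4 → Fin 4) (k : ℕ), Function.Bijective σ ∧ Function.Bijective τ ∧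
      u = maskOf ((baseCells k).map (imgCell σ τ)) := by
  unfold imageMasks at hu
  obtain ⟨w, hw, rfl⟩ := List.mem_map.1 hu
  have hlt := List.all_eq_true.1 witParams_lt w hw
  simp only [Bool.and_eq_true, decide_eq_true_eq] at hlt
  refine ⟨perms4.getD w.1 id, perms4.getD w.2.1 id, w.2.2, ?_, ?_, rfl⟩
  · exact perms4_bijective _ (by
      rw [List.getD_eq_getElem _ _ (by simpa [perms4] using hlt.1)]; exact List.getElem_mem _)
  · exact perms4_bijective _ (by
      rw [List.getD_eq_getElem _ _ (by simpa [perms4] using hlt.2)]; exact List.getElem_mem _)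

end Summit.ValiantsHypothesis.ValiantsHypothesis.Cruxes.CoverDecancellation.SingPerFourSupport


/-!
# The support theorem for `Sing(per₄)`
# (helper for crux `CoverDecancellation`, `--supports` stmt-ValiantsHypothesis-17819; RULING g12-R132 (a))

**Theorem** (`support_of_subperm_vanish`).  Let `R` be a commutative domain with `(12 : R) ≠ 0` and
`M : Matrix (Fin 4) (Fin 4) R` a matrix all of whose sixteen `3 × 3` sub-permanents vanish — over `ℂ`,
a point of `Sing(per₄) = V(∂ per₄)`.  Then

* `M` has a zero ROW, or a zero COLUMN, or
* an ANTI-BLOCK zero pattern: `M i j = 0` whenever `[i ∈ I] = [j ∈ J]`, for 2-sets `I, J ⊆ [4]`, or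
* CROSS support: `M i j = 0` off `row i₀ ∪ column j₀`.

All four occur on `Sing(per₄)` (two zero lines; one zero row `[u;v;w;0]` with `det B(u,v) = 0`,
`w ∈ ker B(u,v)`, `B(u,v)ᵢⱼ = uᵢvⱼ + uⱼvᵢ` — an 8-dimensional family whose general member has exactly four
zeros; anti-block with `per A = per B = 0`; the 7-dimensional linear space of cross matrices), so the
list is sharp as a list of zero patterns; `12 ≠ 0` is needed (in characteristic 3 every rank-one
matrix is singular on `per₄ = 0`).

Proof.  By `SymPencilPerFourSingularLocusSupportCover.checkSorted_eq` (kernel) every zero pattern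
with sorted row and column zero-counts contains a terminal pattern (done) or misses one of the 720
images of the supports `U₁`, `U₂`, `U₂ᵀ` of the monomials of
`SymPencilPerFourSingularLocusSupportMonomials`; in the latter case the reindexed (transposed) matrix
has all entries of `U₁`/`U₂` non-zero, contradicting `12 · monomial = 0` in a domain.  A general `M`
is first brought to sorted form by a row and a column permutation (`Tuple.sort` on the zero counts),
which preserves the hypothesis, and the conclusion is transported back.

Use.  Closes `stub_noZeroLine_zeros` of `Cruxes/CoverDecancellation/Lines/sing_height_cascade.lean`
(val-idea-18) by name, and is PART A of the kernel proof of `codim Sing(per₄) ≥ 7`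
(`Lines/sing_per4_height.lean`, val-idea-10), the input `h7` of the rung `StrengthTwoPerFourGeFour`
(«str₂(per₄) ≥ 4», `PolyaContinuedLaplaceRigidity.Strength.strengthTwoPerFourGeFour_of_seven_le_height`).
No summit-level statement is touched.  val-idea-10 g2, 2026-08-28.  No `sorry`, no new definitions.
-/


namespace Summit.ValiantsHypothesis.ValiantsHypothesis.Cruxes.CoverDecancellation.SingPerFourSupport

open Matrix
open Summit.ValiantsHypothesis.ValiantsHypothesis.Theorems.SymPencilPerFourSingularLocusSupportMonomials

variable {R : Type*} [CommRing R]

/-! ## §1 The hypothesis is stable under reindexing and transposition -/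

/-- The minors `M.submatrix r.succAbove c.succAbove` as sub-permanents. -/
theorem permanent_minor_eq_subperm (N : Matrix (Fin 4) (Fin 4) R) (r c : Fin 4) :
    (N.submatrix r.succAbove c.succAbove).permanent = N.subperm (· ≠ c) (· ≠ r) := by
  rw [N.subperm_eq_permanent_of_equiv (finSuccAboveEquiv c) (finSuccAboveEquiv r)]
  rfl

/-- Row and column permutations preserve «all `3 × 3` sub-permanents vanish». -/
theorem subpermVanish_reindex {M : Matrix (Fin 4) (Fin 4) R}
    (h : ∀ r c : Fin 4, (M.submatrix r.succAbove c.succAbove).permanent = 0)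
    (σ τ : Equiv.Perm (Fin 4)) (r c : Fin 4) :
    ((M.submatrix σ τ).submatrix r.succAbove c.succAbove).permanent = 0 := by
  have key : ((M.submatrix σ τ).submatrix r.succAbove c.succAbove).permanent =
      M.subperm (· ≠ τ c) (· ≠ σ r) := by
    rw [M.subperm_eq_permanent_of_equiv
      ((finSuccAboveEquiv c).trans (τ.subtypeEquiv fun a => by simp [τ.injective.ne_iff]))
      ((finSuccAboveEquiv r).trans (σ.subtypeEquiv fun a => by simp [σ.injective.ne_iff]))]
    rfl
  rw [key, ← permanent_minor_eq_subperm]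
  exact h (σ r) (τ c)

/-- Transposition preserves «all `3 × 3` sub-permanents vanish». -/
theorem subpermVanish_transpose {M : Matrix (Fin 4) (Fin 4) R}
    (h : ∀ r c : Fin 4, (M.submatrix r.succAbove c.succAbove).permanent = 0) (r c : Fin 4) :
    (Mᵀ.submatrix r.succAbove c.succAbove).permanent = 0 := by
  rw [← transpose_submatrix, permanent_transpose]
  exact h c r

/-! ## §2 The zero pattern as a mask, and its row / column counts -/

/-- The zero pattern of `M` is a 16-bit mask. -/
theorem exists_zmask (M : Matrix (Fin 4) (Fin 4) R) :
    ∃ z : ℕ, z < 65536 ∧ ∀ c : Fin 4 × Fin 4, z.testBit (bitIdx c) = true ↔ M c.1 c.2 = 0 := by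
  classical
  refine ⟨maskOf (allCells.filter fun c => decide (M c.1 c.2 = 0)), ?_, fun c => ?_⟩
  · have : maskOf (allCells.filter fun c => decide (M c.1 c.2 = 0)) < 2 ^ 16 := by
      refine Nat.lt_pow_two_of_testBit _ fun i hi => ?_
      cases h : (maskOf (allCells.filter fun c => decide (M c.1 c.2 = 0))).testBit i with
      | false => rfl
      | true =>
          exfalso
          obtain ⟨c, -, hc⟩ := (testBit_maskOf _ _).1 h
          have := bitIdx_lt c
          omega
    simpa using this
  · rw [testBit_maskOf]
    constructor
    · rintro ⟨c', hc', he⟩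
      obtain rfl := bitIdx_injective he
      simpa [List.mem_filter, mem_allCells] using hc'
    · intro h0
      exact ⟨c, by simpa [List.mem_filter, mem_allCells] using h0, rfl⟩

/-- One bit as an indicator. -/
theorem toNat_testBit_eq {M : Matrix (Fin 4) (Fin 4) R} {z : ℕ} [DecidableEq R]
    (hz : ∀ c : Fin 4 × Fin 4, z.testBit (bitIdx c) = true ↔ M c.1 c.2 = 0) (i j : Fin 4) :
    (z.testBit (bitIdx (i, j))).toNat = if M i j = 0 then 1 else 0 := by
  by_cases h : M i j = 0
  · rw [(hz (i, j)).2 h]; simp [h]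
  · have : z.testBit (bitIdx (i, j)) = false := by
      cases hb : z.testBit (bitIdx (i, j)) with
      | false => rfl
      | true => exact absurd ((hz (i, j)).1 hb) h
    rw [this]; simp [h]

/-- Row zero-counts of the mask are row zero-counts of the matrix. -/
theorem rcnt_eq_card {M : Matrix (Fin 4) (Fin 4) R} {z : ℕ} [DecidableEq R]
    (hz : ∀ c : Fin 4 × Fin 4, z.testBit (bitIdx c) = true ↔ M c.1 c.2 = 0) (i : Fin 4) :
    rcnt z i = (Finset.univ.filter fun j : Fin 4 => M i j = 0).card := by
  rw [Finset.card_filter, Fin.sum_univ_four, ← toNat_testBit_eq hz, ← toNat_testBit_eq hz,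
    ← toNat_testBit_eq hz, ← toNat_testBit_eq hz]
  simp only [rcnt, bitIdx]
  fin_cases i <;> rfl

/-- Column zero-counts of the mask are column zero-counts of the matrix. -/
theorem ccnt_eq_card {M : Matrix (Fin 4) (Fin 4) R} {z : ℕ} [DecidableEq R]
    (hz : ∀ c : Fin 4 × Fin 4, z.testBit (bitIdx c) = true ↔ M c.1 c.2 = 0) (j : Fin 4) :
    ccnt z j = (Finset.univ.filter fun i : Fin 4 => M i j = 0).card := by
  rw [Finset.card_filter, Fin.sum_univ_four, ← toNat_testBit_eq hz, ← toNat_testBit_eq hz,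
    ← toNat_testBit_eq hz, ← toNat_testBit_eq hz]
  simp only [ccnt, bitIdx]
  fin_cases j <;> rfl

/-! ## §3 Sorting rows and columns by their zero counts -/

/-- Some row permutation and some column permutation make both zero-count sequences monotone. -/
theorem exists_sorted [DecidableEq R] (M : Matrix (Fin 4) (Fin 4) R) :
    ∃ σ τ : Equiv.Perm (Fin 4),
      Monotone (fun i => (Finset.univ.filter fun j : Fin 4 => M.submatrix σ τ i j = 0).card) ∧
      Monotone (fun j => (Finset.univ.filter fun i : Fin 4 => M.submatrix σ τ i j = 0).card) := by
  set f : Fin 4 → ℕ := fun i => (Finset.univ.filter fun j : Fin 4 => M i j = 0).card with hf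
  set g : Fin 4 → ℕ := fun j => (Finset.univ.filter fun i : Fin 4 => M i j = 0).card with hg
  refine ⟨Tuple.sort f, Tuple.sort g, ?_, ?_⟩
  · have hrow : ∀ (σ τ : Equiv.Perm (Fin 4)) (i : Fin 4),
        (Finset.univ.filter fun j : Fin 4 => M.submatrix σ τ i j = 0).card = f (σ i) := by
      intro σ τ i
      simp only [hf, submatrix_apply]
      exact Finset.card_bij (fun j _ => τ j) (fun j hj => by simpa using hj)
        (fun a _ b _ h => τ.injective h)
        (fun b hb => ⟨τ.symm b, by simpa using hb, by simp⟩)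
    simp only [hrow]
    exact Tuple.monotone_sort f
  · have hcol : ∀ (σ τ : Equiv.Perm (Fin 4)) (j : Fin 4),
        (Finset.univ.filter fun i : Fin 4 => M.submatrix σ τ i j = 0).card = g (τ j) := by
      intro σ τ j
      simp only [hg, submatrix_apply]
      exact Finset.card_bij (fun i _ => σ i) (fun i hi => by simpa using hi)
        (fun a _ b _ h => σ.injective h)
        (fun b hb => ⟨σ.symm b, by simpa using hb, by simp⟩)
    simp only [hcol]
    exact Tuple.monotone_sort g

/-- Transport of the four-way conclusion along a reindexing. -/
theorem concl_of_submatrix (M : Matrix (Fin 4) (Fin 4) R) (σ τ : Equiv.Perm (Fin 4))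
    (h : (∃ i : Fin 4, ∀ j : Fin 4, M.submatrix σ τ i j = 0) ∨
      (∃ j : Fin 4, ∀ i : Fin 4, M.submatrix σ τ i j = 0) ∨
      (∃ i₁ i₂ j₁ j₂ : Fin 4, i₁ ≠ i₂ ∧ j₁ ≠ j₂ ∧
        ∀ i j : Fin 4, ((i = i₁ ∨ i = i₂) ↔ (j = j₁ ∨ j = j₂)) → M.submatrix σ τ i j = 0) ∨
      (∃ i₀ j₀ : Fin 4, ∀ i j : Fin 4, i ≠ i₀ → j ≠ j₀ → M.submatrix σ τ i j = 0)) :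
    (∃ i : Fin 4, ∀ j : Fin 4, M i j = 0) ∨ (∃ j : Fin 4, ∀ i : Fin 4, M i j = 0) ∨
    (∃ i₁ i₂ j₁ j₂ : Fin 4, i₁ ≠ i₂ ∧ j₁ ≠ j₂ ∧
        ∀ i j : Fin 4, ((i = i₁ ∨ i = i₂) ↔ (j = j₁ ∨ j = j₂)) → M i j = 0) ∨
    (∃ i₀ j₀ : Fin 4, ∀ i j : Fin 4, i ≠ i₀ → j ≠ j₀ → M i j = 0) := by
  simp only [submatrix_apply] at h
  rcases h with ⟨i, hi⟩ | ⟨j, hj⟩ | ⟨i₁, i₂, j₁, j₂, hne, hne', hH⟩ | ⟨i₀, j₀, hX⟩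
  · exact Or.inl ⟨σ i, fun j => by simpa using hi (τ.symm j)⟩
  · exact Or.inr (Or.inl ⟨τ j, fun i => by simpa using hj (σ.symm i)⟩)
  · refine Or.inr (Or.inr (Or.inl ⟨σ i₁, σ i₂, τ j₁, τ j₂, σ.injective.ne hne, τ.injective.ne hne',
      fun i j hij => ?_⟩))
    have := hH (σ.symm i) (τ.symm j) (by
      simpa only [Equiv.symm_apply_eq, eq_comm (a := i), eq_comm (a := j)] using hij)
    simpa using this
  · refine Or.inr (Or.inr (Or.inr ⟨σ i₀, τ j₀, fun i j hi hj => ?_⟩))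
    have := hX (σ.symm i) (τ.symm j) (by simpa [Equiv.symm_apply_eq] using hi)
      (by simpa [Equiv.symm_apply_eq] using hj)
    simpa using this

/-! ## §4 The support theorem -/

/-- The sorted case: read the kernel cover fact. -/
theorem support_of_sorted [IsDomain R] [DecidableEq R] (h12 : (12 : R) ≠ 0)
    (N : Matrix (Fin 4) (Fin 4) R)
    (hN : ∀ r c : Fin 4, (N.submatrix r.succAbove c.succAbove).permanent = 0)
    (hrow : Monotone (fun i => (Finset.univ.filter fun j : Fin 4 => N i j = 0).card))
    (hcol : Monotone (fun j => (Finset.univ.filter fun i : Fin 4 => N i j = 0).card)) :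
    (∃ i : Fin 4, ∀ j : Fin 4, N i j = 0) ∨ (∃ j : Fin 4, ∀ i : Fin 4, N i j = 0) ∨
    (∃ i₁ i₂ j₁ j₂ : Fin 4, i₁ ≠ i₂ ∧ j₁ ≠ j₂ ∧
        ∀ i j : Fin 4, ((i = i₁ ∨ i = i₂) ↔ (j = j₁ ∨ j = j₂)) → N i j = 0) ∨
    (∃ i₀ j₀ : Fin 4, ∀ i j : Fin 4, i ≠ i₀ → j ≠ j₀ → N i j = 0) := by
  classical
  obtain ⟨z, hz, hzb⟩ := exists_zmask N
  -- the mask is count-sorted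
  have hs : sortedB z = true := by
    have r := rcnt_eq_card hzb
    have c := ccnt_eq_card hzb
    have m01 := hrow (show (0 : Fin 4) ≤ 1 by decide)
    have m12 := hrow (show (1 : Fin 4) ≤ 2 by decide)
    have m23 := hrow (show (2 : Fin 4) ≤ 3 by decide)
    have n01 := hcol (show (0 : Fin 4) ≤ 1 by decide)
    have n12 := hcol (show (1 : Fin 4) ≤ 2 by decide)
    have n23 := hcol (show (2 : Fin 4) ≤ 3 by decide)
    simp only at m01 m12 m23 n01 n12 n23
    rw [← r, ← r] at m01 m12 m23
    rw [← c, ← c] at n01 n12 n23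
    simp only [sortedB, Bool.and_eq_true, decide_eq_true_eq]
    exact ⟨⟨⟨m01, m12⟩, m23⟩, ⟨n01, n12⟩, n23⟩
  have hok := ok_of_sorted z hz hs
  unfold ok at hok
  rw [Bool.or_eq_true, List.any_eq_true, List.any_eq_true] at hok
  have rd : ∀ c : Fin 4 × Fin 4, z.testBit (bitIdx c) = true → N c.1 c.2 = 0 :=
    fun c hc => (hzb c).1 hc
  rcases hok with ⟨m, hm, hzm⟩ | ⟨u, hu, hzu⟩
  · -- a terminal pattern inside the zero pattern
    have hzm' : z &&& m = m := by simpa using hzm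
    have up : ∀ c : Fin 4 × Fin 4, m.testBit (bitIdx c) = true → N c.1 c.2 = 0 :=
      fun c hc => rd c (testBit_of_and_eq_self hzm' _ hc)
    rcases termSem_of_mem_termGen hm with ⟨i, hi⟩ | ⟨j, hj⟩ | ⟨i₁, i₂, j₁, j₂, hne, hne', hH⟩ |
      ⟨i₀, j₀, hX⟩
    · exact Or.inl ⟨i, fun j => up (i, j) (hi j)⟩
    · exact Or.inr (Or.inl ⟨j, fun i => up (i, j) (hj i)⟩)
    · exact Or.inr (Or.inr (Or.inl ⟨i₁, i₂, j₁, j₂, hne, hne', fun i j hij => up (i, j) (hH i j hij)⟩))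
    · exact Or.inr (Or.inr (Or.inr ⟨i₀, j₀, fun i j hi hj => up (i, j) (hX i j hi hj)⟩))
  · -- an image of `U₁ / U₂ / U₂ᵀ` avoids the zero pattern: contradiction in a domain
    exfalso
    have hzu' : z &&& u = 0 := by simpa using hzu
    have nz : ∀ c : Fin 4 × Fin 4, u.testBit (bitIdx c) = true → N c.1 c.2 ≠ 0 := by
      intro c hc h0
      have := testBit_of_and_eq_zero hzu' _ hc
      rw [(hzb c).2 h0] at this
      exact Bool.noConfusion this
    obtain ⟨σ, τ, k, hσ, hτ, rfl⟩ := exists_wit_of_mem_imageMasks hu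
    set σe := Equiv.ofBijective σ hσ
    set τe := Equiv.ofBijective τ hτ
    have hcell : ∀ c ∈ baseCells k, N (σ c.1) (τ c.2) ≠ 0 := by
      intro c hc
      apply nz (imgCell σ τ c)
      rw [testBit_maskOf]
      exact ⟨imgCell σ τ c, List.mem_map.2 ⟨c, hc, rfl⟩, rfl⟩
    have hN' := subpermVanish_reindex hN σe τe
    have e : ∀ i j, N.submatrix σe τe i j = N (σ i) (τ j) := fun i j => rfl
    rcases k with _ | _ | k
    · -- `U₁`
      have h := twelve_mul_monomial₁_eq_zero (N.submatrix σe τe) hN'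
      simp only [e] at h
      refine (mul_ne_zero h12 ?_) h
      have a := hcell (0,2) (by decide); have b := hcell (0,3) (by decide)
      have c := hcell (1,1) (by decide); have d := hcell (2,0) (by decide)
      have f := hcell (3,0) (by decide)
      exact mul_ne_zero (mul_ne_zero (mul_ne_zero (mul_ne_zero a b) (pow_ne_zero 3 c)) d)
        (pow_ne_zero 3 f)
    · -- `U₂`
      have h := twelve_mul_monomial₂_eq_zero (N.submatrix σe τe) hN'
      simp only [e] at h
      refine (mul_ne_zero h12 ?_) h
      have a := hcell (0,0) (by decide); have b := hcell (0,1) (by decide)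
      have c := hcell (0,3) (by decide); have d := hcell (1,2) (by decide)
      have f := hcell (2,1) (by decide); have g := hcell (3,0) (by decide)
      exact mul_ne_zero (mul_ne_zero (mul_ne_zero (mul_ne_zero (mul_ne_zero a b) c)
        (pow_ne_zero 2 d)) (pow_ne_zero 2 f)) (pow_ne_zero 2 g)
    · -- `U₂ᵀ`: apply the second monomial to the transpose
      have h := twelve_mul_monomial₂_eq_zero (N.submatrix σe τe)ᵀ (subpermVanish_transpose hN')
      simp only [transpose_apply, e] at h
      refine (mul_ne_zero h12 ?_) h
      have a := hcell (0,0) (by simp [baseCells]); have b := hcell (1,0) (by simp [baseCells])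
      have c := hcell (3,0) (by simp [baseCells]); have d := hcell (2,1) (by simp [baseCells])
      have f := hcell (1,2) (by simp [baseCells]); have g := hcell (0,3) (by simp [baseCells])
      exact mul_ne_zero (mul_ne_zero (mul_ne_zero (mul_ne_zero (mul_ne_zero a b) c)
        (pow_ne_zero 2 d)) (pow_ne_zero 2 f)) (pow_ne_zero 2 g)

/-- **Support theorem for `Sing(per₄)`.**  In a domain with `12 ≠ 0`, a `4 × 4` matrix all of whose
`3 × 3` sub-permanents vanish has a zero row, a zero column, an anti-block zero pattern, or is
supported on a cross `row i₀ ∪ column j₀`. -/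
theorem support_of_subperm_vanish [IsDomain R] (h12 : (12 : R) ≠ 0)
    (M : Matrix (Fin 4) (Fin 4) R)
    (h : ∀ r c : Fin 4, (M.submatrix r.succAbove c.succAbove).permanent = 0) :
    (∃ i : Fin 4, ∀ j : Fin 4, M i j = 0) ∨ (∃ j : Fin 4, ∀ i : Fin 4, M i j = 0) ∨
    (∃ i₁ i₂ j₁ j₂ : Fin 4, i₁ ≠ i₂ ∧ j₁ ≠ j₂ ∧
        ∀ i j : Fin 4, ((i = i₁ ∨ i = i₂) ↔ (j = j₁ ∨ j = j₂)) → M i j = 0) ∨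
    (∃ i₀ j₀ : Fin 4, ∀ i j : Fin 4, i ≠ i₀ → j ≠ j₀ → M i j = 0) := by
  classical
  obtain ⟨σ, τ, hrow, hcol⟩ := exists_sorted M
  exact concl_of_submatrix M σ τ
    (support_of_sorted h12 (M.submatrix σ τ) (subpermVanish_reindex h σ τ) hrow hcol)

/-- The same over `ℂ` (the case used for `Sing(per₄)`), hypothesis-free. -/
theorem support_of_subperm_vanish_complex (M : Matrix (Fin 4) (Fin 4) ℂ)
    (h : ∀ r c : Fin 4, (M.submatrix r.succAbove c.succAbove).permanent = 0) :
    (∃ i : Fin 4, ∀ j : Fin 4, M i j = 0) ∨ (∃ j : Fin 4, ∀ i : Fin 4, M i j = 0) ∨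
    (∃ i₁ i₂ j₁ j₂ : Fin 4, i₁ ≠ i₂ ∧ j₁ ≠ j₂ ∧
        ∀ i j : Fin 4, ((i = i₁ ∨ i = i₂) ↔ (j = j₁ ∨ j = j₂)) → M i j = 0) ∨
    (∃ i₀ j₀ : Fin 4, ∀ i j : Fin 4, i ≠ i₀ → j ≠ j₀ → M i j = 0) :=
  support_of_subperm_vanish (by norm_num) M h

end Summit.ValiantsHypothesis.ValiantsHypothesis.Cruxes.CoverDecancellation.SingPerFourSupport
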